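import Literature.NumberTheory.NumberFields.CubicFieldDedekindKummer
import HarnessLib

/-!
# Explicit cubic fields: degree-one primes as kernels of residue maps `𝓞 K → ℤ/p`

Continuation of `CubicFieldConductor.lean` / `CubicFieldDedekindKummer.lean` for `K = ℚ(θ)`, `θ` a root of
the monic irreducible `f = X³ + aX² + bX + c ∈ ℤ[X]`, with a conductor bound `N · 𝓞 K ⊆ ℤ[θ]`
(D. A. Marcus, *Number Fields*, 2nd ed. (2018), Ch. 3, Thm. 27: for `p ∤ [𝓞 K : ℤ[θ]]` the primes above `p`
are the `(p, Q(θ))`, `Q̄ ∣ f̄` irreducible, of residue degree `deg Q̄`). This file packages the DEGREE-ONE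
primes in the form in which explicit descents use them — as KERNELS of residue homomorphisms — so that
membership of an explicit algebraic integer is a congruence and valuations can be certified by membership:

* `ker_zmod_isMaximal`, `absNorm_ker_zmod`, `natCast_mem_ker_zmod`, `ker_zmod_ne_bot`,
  `ker_zmod_mem_primesOver` — for ANY number field `K` and ANY ring homomorphism `ψ : 𝓞 K → ℤ/p`
  (`p` prime): `ker ψ` is a maximal ideal of norm `p` above `p` (`𝓞 K / ker ψ ≅ ℤ/p`);
  `eq_ker_zmod_of_le` — a prime above `p` contained in `ker ψ` equals it; `ker_ne_ker_of_apply_ne`,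
  `ker_ne_ker_of_ne` — kernels of residue maps with different values (or different `p`) are different primes.
* `MonicCubic.exists_residueHom` — for a root `r` of `f mod p` with `p ∤ N` there IS a residue map
  `ψ : 𝓞 K → ℤ/p` with `ψ(θ) = r` (`CubicFieldConductor.exists_ringHom_of_root_of_mul_mem`), unique
  (`MonicCubic.residueHom_unique`: a ring map `𝓞 K → ℤ/p` is determined by `ψ(θ)` when `p ∤ N`), and its kernel
  is the Dedekind–Kummer prime: `MonicCubic.ker_residueHom_eq_span` — `ker ψ = (p, θ - r)`.

Everything is proved; theorems only (no definitions: the residue maps are obtained from `exists_residueHom`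
and carried as hypotheses `ψ (thetaInt hθ) = r`). Written for the `2`-division field of `E_{28/9}`
(`CubicField14483.lean`: `N = 3` for `γ`, `N = 4` for `δ`).

## References
* [Marcus2018] D. A. Marcus, *Number Fields*, 2nd ed. (2018), Ch. 3, Thm. 27 and its proof (the map
  `ℤ[θ] → ℤ[X]/(p, Q) ≅ 𝔽_p[X]/(Q̄)`).
-/

noncomputable section

open Polynomial Module NumberField Ideal
open scoped NumberField

namespace Literature.NumberTheory.NumberFields

variable {K : Type*} [Field K] [NumberField K]

/-! ### Kernels of ring homomorphisms `𝓞 K → ℤ/p` -/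

section KerZMod

variable {p : ℕ} [hp : Fact p.Prime] (ψ : 𝓞 K →+* ZMod p)

omit [NumberField K] in
/-- A ring homomorphism `𝓞 K → ℤ/p` is surjective, so its kernel is a maximal ideal.
[cite: Marcus2018, Ch. 3, Thm. 27 (proof)] -/
theorem ker_zmod_isMaximal : (RingHom.ker ψ).IsMaximal :=
  RingHom.ker_isMaximal_of_surjective ψ (ZMod.ringHom_surjective ψ)

/-- **`N(ker ψ) = p`**: `𝓞 K / ker ψ ≅ ℤ/p`. [cite: Marcus2018, Ch. 3, Thm. 27 (proof)] -/
theorem absNorm_ker_zmod : absNorm (RingHom.ker ψ) = p := by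
  have e := RingHom.quotientKerEquivOfSurjective (ZMod.ringHom_surjective ψ)
  rw [Ideal.absNorm_apply, Submodule.cardQuot_apply, Nat.card_congr e.toEquiv, Nat.card_zmod]

omit [NumberField K] in
/-- `p ∈ ker ψ`. [cite: Marcus2018, Ch. 3, Thm. 27 (proof)] -/
theorem natCast_mem_ker_zmod : (p : 𝓞 K) ∈ RingHom.ker ψ := by
  rw [RingHom.mem_ker, map_natCast, ZMod.natCast_self]

/-- `ker ψ ≠ 0`. [cite: Marcus2018, Ch. 3, Thm. 27 (proof)] -/
theorem ker_zmod_ne_bot : RingHom.ker ψ ≠ ⊥ := by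
  intro h0
  have h := absNorm_ker_zmod ψ
  rw [h0, Ideal.absNorm_bot] at h
  exact hp.out.ne_zero h.symm

omit [NumberField K] in
/-- A prime `P` of `𝓞 K` containing the rational prime `p` lies over `(p) ⊂ ℤ`. [cite: Marcus2018, Ch. 3, Thm. 27 (proof)] -/
theorem mem_primesOver_of_natCast_mem {P : Ideal (𝓞 K)} [hP : P.IsPrime] (hmem : (p : 𝓞 K) ∈ P) :
    P ∈ primesOver (span {(p : ℤ)}) (𝓞 K) := by
  refine ⟨hP, ⟨?_⟩⟩
  refine (Int.ideal_span_isMaximal_of_prime p).eq_of_le (Ideal.comap_ne_top _ hP.ne_top) ?_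
  rw [Ideal.span_singleton_le_iff_mem, Ideal.mem_comap, map_natCast]
  exact hmem

omit [NumberField K] hp in
/-- A prime of `𝓞 K` above `(p)` contains `p`. [cite: Marcus2018, Ch. 3, Thm. 27 (proof)] -/
theorem natCast_mem_of_mem_primesOver' {P : Ideal (𝓞 K)} (hP : P ∈ primesOver (span {(p : ℤ)}) (𝓞 K)) :
    (p : 𝓞 K) ∈ P := by
  have h : ((p : ℤ) : 𝓞 K) ∈ P := by
    have hu : (p : ℤ) ∈ P.under ℤ := by rw [← hP.2.over]; exact Ideal.mem_span_singleton_self _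
    exact hu
  simpa using h

omit [NumberField K] in
/-- **`ker ψ` is a prime of `𝓞 K` above `p`** (of residue degree one). [cite: Marcus2018, Ch. 3, Thm. 27 (proof)] -/
theorem ker_zmod_mem_primesOver : RingHom.ker ψ ∈ primesOver (span {(p : ℤ)}) (𝓞 K) :=
  haveI := (ker_zmod_isMaximal ψ).isPrime
  mem_primesOver_of_natCast_mem (natCast_mem_ker_zmod ψ)

/-- A prime above `p` contained in `ker ψ` IS `ker ψ` (nonzero primes of `𝓞 K` are maximal).
[cite: Marcus2018, Ch. 3, Thm. 27 (proof)] -/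
theorem eq_ker_zmod_of_le {P : Ideal (𝓞 K)} (hP : P ∈ primesOver (span {(p : ℤ)}) (𝓞 K))
    (hle : P ≤ RingHom.ker ψ) : P = RingHom.ker ψ := by
  have hPne : P ≠ ⊥ := by
    intro h0
    have hmem := natCast_mem_of_mem_primesOver' hP
    rw [h0, Ideal.mem_bot] at hmem
    exact hp.out.ne_zero (by exact_mod_cast hmem)
  haveI := hP.1
  exact (Ring.DimensionLEOne.maximalOfPrime hPne hP.1).eq_of_le (ker_zmod_isMaximal ψ).ne_top hle

omit [NumberField K] in
/-- **Residue maps with different values on one element have different kernels.**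
[cite: Marcus2018, Ch. 3, Thm. 27 (proof)] -/
theorem ker_ne_ker_of_apply_ne {q : ℕ} (ψ' : 𝓞 K →+* ZMod q) {x : 𝓞 K} {r : ℤ}
    (hx : ψ x = r) (hx' : ψ' x ≠ r) (hpq : p = q) : RingHom.ker ψ ≠ RingHom.ker ψ' := by
  subst hpq
  intro heq
  have hmem : x - (r : 𝓞 K) ∈ RingHom.ker ψ := by rw [RingHom.mem_ker, map_sub, hx, map_intCast, sub_self]
  rw [heq, RingHom.mem_ker, map_sub, map_intCast, sub_eq_zero] at hmem
  exact hx' hmem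

omit [NumberField K] in
/-- Kernels of residue maps to `ℤ/p` and `ℤ/q`, `p ≠ q`, are different primes. [cite: Marcus2018, Ch. 3, Thm. 27 (proof)] -/
theorem ker_ne_ker_of_ne {q : ℕ} [hq : Fact q.Prime] (ψ' : 𝓞 K →+* ZMod q) (hpq : p ≠ q) :
    RingHom.ker ψ ≠ RingHom.ker ψ' := by
  intro heq
  have hmem : (p : 𝓞 K) ∈ RingHom.ker ψ' := heq ▸ natCast_mem_ker_zmod ψ
  rw [RingHom.mem_ker, map_natCast, ZMod.natCast_eq_zero_iff] at hmem
  exact hpq ((Nat.prime_dvd_prime_iff_eq hq.out hp.out).mp hmem).symm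

end KerZMod

namespace MonicCubic

variable {a b c : ℤ} {θ : K}

/-! ### Residue maps of an explicit cubic field at a root of `f mod p` -/

/-- **The residue map at a root.** If `N · 𝓞 K ⊆ ℤ[θ]`, `p ∤ N` and `r` is a root of `f` modulo `p`, there
is a ring homomorphism `ψ : 𝓞 K → ℤ/p` with `ψ(θ) = r` (Marcus: `ℤ[θ] → ℤ[θ]/(p, θ - r) ≅ 𝔽_p`, extended
to `𝓞 K` because `N` is invertible mod `p`). [cite: Marcus2018, Ch. 3, Thm. 27 (proof)] -/
theorem exists_residueHom (hirr : Irreducible (polyQ a b c)) (hθ : aeval θ (poly a b c) = 0)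
    (h3 : finrank ℚ K = 3) {N : ℕ} (hN : ∀ x : 𝓞 K, (N : K) * x ∈ Algebra.adjoin ℤ ({θ} : Set K))
    {p : ℕ} [hp : Fact p.Prime] (hpN : ¬ p ∣ N) (r : ℤ)
    (hr : (r : ZMod p) ^ 3 + (a : ZMod p) * (r : ZMod p) ^ 2 + (b : ZMod p) * r + (c : ZMod p) = 0) :
    ∃ ψ : 𝓞 K →+* ZMod p, ψ (thetaInt hθ) = r := by
  have hN0 : (N : ZMod p) ≠ 0 := by rwa [Ne, ZMod.natCast_eq_zero_iff]
  exact exists_ringHom_of_root_of_mul_mem hirr hθ h3 hN (r : ZMod p) (by exact_mod_cast hr) (N : ZMod p)⁻¹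
    (mul_inv_cancel₀ hN0)

/-- **A ring homomorphism `𝓞 K → ℤ/p` is determined by its value on `θ`** when `N · 𝓞 K ⊆ ℤ[θ]`, `p ∤ N`
(`N x` is an integer polynomial in `θ`). [cite: Marcus2018, Ch. 3, Thm. 27 (proof)] -/
theorem residueHom_unique (hθ : aeval θ (poly a b c) = 0)
    {N : ℕ} (hN : ∀ x : 𝓞 K, (N : K) * x ∈ Algebra.adjoin ℤ ({θ} : Set K))
    {p : ℕ} [hp : Fact p.Prime] (hpN : ¬ p ∣ N) (ψ ψ' : 𝓞 K →+* ZMod p)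
    (h : ψ (thetaInt hθ) = ψ' (thetaInt hθ)) : ψ = ψ' := by
  have hN0 : (N : ZMod p) ≠ 0 := by rwa [Ne, ZMod.natCast_eq_zero_iff]
  refine RingHom.ext fun x => ?_
  -- `N x = g(θ)` for an integer polynomial `g`
  have hx := hN x
  rw [Algebra.adjoin_singleton_eq_range_aeval] at hx
  obtain ⟨g, hg⟩ := hx
  have hgx : (N : 𝓞 K) * x = aeval (thetaInt hθ) g := by
    apply IsFractionRing.injective (𝓞 K) K
    rw [map_mul, map_natCast]
    change (N : K) * (x : K) = algebraMap (𝓞 K) K (aeval (thetaInt hθ) g)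
    rw [← aeval_algebraMap_apply]
    exact hg.symm
  have hev : ∀ φ : 𝓞 K →+* ZMod p, φ (aeval (thetaInt hθ) g) = eval₂ (algebraMap ℤ (ZMod p)) (φ (thetaInt hθ)) g :=
    fun φ => by
    rw [aeval_def, hom_eval₂, RingHom.ext_int (φ.comp (algebraMap ℤ (𝓞 K))) (algebraMap ℤ (ZMod p))]
  have key : (N : ZMod p) * ψ x = (N : ZMod p) * ψ' x := by
    have e1 := congrArg ψ hgx
    have e2 := congrArg ψ' hgx
    rw [map_mul, map_natCast, hev] at e1
    rw [map_mul, map_natCast, hev] at e2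
    rw [e1, e2, h]
  exact mul_left_cancel₀ hN0 key

/-- **The kernel of the residue map at `r` is the Dedekind–Kummer prime `(p, θ - r)`** (when
`p ∤ exponent(θ)`, e.g. `p ∤ N`). [cite: Marcus2018, Ch. 3, Thm. 27] -/
theorem ker_residueHom_eq_span (hirr : Irreducible (polyQ a b c)) (hθ : aeval θ (poly a b c) = 0)
    {p : ℕ} [hp : Fact p.Prime] (hexp : ¬ p ∣ RingOfIntegers.exponent (thetaInt hθ))
    {r : ℤ} (ψ : 𝓞 K →+* ZMod p) (hψ : ψ (thetaInt hθ) = r) :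
    RingHom.ker ψ = span {(p : 𝓞 K), thetaInt hθ - (r : 𝓞 K)} := by
  -- residue degree one: `N(ker ψ) = p`
  have hover := ker_zmod_mem_primesOver ψ
  haveI := hover.2
  haveI := ker_zmod_isMaximal ψ
  haveI := Int.ideal_span_isMaximal_of_prime p
  have hdeg : (RingHom.ker ψ).inertiaDeg ℤ = 1 := by
    have h := Ideal.absNorm_eq_pow_inertiaDeg' (RingHom.ker ψ) hp.out
    rw [absNorm_ker_zmod, Ideal.inertiaDeg'_eq_inertiaDeg] at h
    have h1 : p ^ 1 = p ^ (RingHom.ker ψ).inertiaDeg ℤ := by rw [pow_one]; exact h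
    exact (Nat.pow_right_injective hp.out.two_le h1).symm
  -- Dedekind–Kummer: `ker ψ = (p, θ - r')` for a root `r'`, and `θ - r ∈ ker ψ` forces `r' ≡ r (mod p)`
  obtain ⟨r', -, hspan⟩ := eq_span_pair_of_root' hirr hθ hp.out hexp hover (U := p)
    (by rw [hdeg, pow_one]) (by
      calc p = p ^ 1 := (pow_one p).symm
        _ < p ^ 2 := Nat.pow_lt_pow_right hp.out.one_lt (by norm_num))
  have hmem : thetaInt hθ - (r' : 𝓞 K) ∈ RingHom.ker ψ := by
    rw [hspan]; exact Ideal.subset_span (by simp)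
  rw [RingHom.mem_ker, map_sub, hψ, map_intCast, sub_eq_zero] at hmem
  obtain ⟨k, hk⟩ := (ZMod.intCast_eq_intCast_iff_dvd_sub r' r p).mp hmem.symm
  have e : thetaInt hθ - (r : 𝓞 K) = (thetaInt hθ - (r' : 𝓞 K)) + (-(k : 𝓞 K)) * (p : 𝓞 K) := by
    have hr : (r : ℤ) = r' + p * k := by linarith
    have : (r : 𝓞 K) = (r' : 𝓞 K) + (p : 𝓞 K) * (k : 𝓞 K) := by exact_mod_cast congrArg (Int.cast : ℤ → 𝓞 K) hr
    rw [this]; ring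
  rw [hspan]
  apply le_antisymm
  · rw [Ideal.span_le]
    rintro x hx
    simp only [Set.mem_insert_iff, Set.mem_singleton_iff] at hx
    rcases hx with rfl | rfl
    · exact Ideal.subset_span (by simp)
    · rw [show thetaInt hθ - (r' : 𝓞 K) = (thetaInt hθ - (r : 𝓞 K)) + (k : 𝓞 K) * (p : 𝓞 K) by rw [e]; ring]
      exact Ideal.add_mem _ (Ideal.subset_span (by simp))
        (Ideal.mul_mem_left _ _ (Ideal.subset_span (by simp)))
  · rw [Ideal.span_le]
    rintro x hx
    simp only [Set.mem_insert_iff, Set.mem_singleton_iff] at hx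
    rcases hx with rfl | rfl
    · exact Ideal.subset_span (by simp)
    · rw [e]
      exact Ideal.add_mem _ (Ideal.subset_span (by simp))
        (Ideal.mul_mem_left _ _ (Ideal.subset_span (by simp)))

end MonicCubic

end Literature.NumberTheory.NumberFields

end
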